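import Literature.Analysis.FluidPDE.PeriodicCylinderNeumannGradient
import Mathlib.Analysis.InnerProductSpace.Projection.Submodule
import Mathlib.Analysis.InnerProductSpace.Dual
import HarnessLib

/-!
# The Helmholtz–Weyl decomposition of `L²` on the period cell of the cylinder and weak solutions
of the periodic Neumann problem

Topic `Literature/Analysis/FluidPDE`. Foundational file (definitions with their API; everything
proved, no named facts) for the local existence theory of the incompressible Euler equations in the
periodic cylinder `{r ≤ 1} × ℝ/Lℤ` (T. Kato, C. Y. Lai, *Nonlinear evolution equations and the Euler
flow*, J. Funct. Anal. **56** (1984) 15–28, Thm I/II; the tree's named fact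
`Literature.Analysis.FluidPDE.KatoLai1984_periodicCylinderUniformExistence`, `Ferrari1993Continuation.lean`).
Kato–Lai's proof (§5, pp. 20–23) solves the modified equation `∂ₜu + F(Pu, u) − QF(Pu, Pu) = 0` in the
full `H^s`, where `P` "denotes the orthogonal projection of `H⁰(Ω; ℝᵐ) = L²(Ω; ℝᵐ)` onto the subspace
`H⁰_σ` of solenoidal vectors" and `Q = 1 − P` (§2, p. 16; §4 (i): "`P` maps `H^s` onto `H^s_σ`
continuously"), and concludes with `‖Qu(t)‖₀ = const = 0` (p. 22–23). The one piece of analysis on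
the domain with boundary that every step of that programme rests on is the **Neumann problem** for
the Laplacian in the cylinder, periodic in `z` — `Qw = ∇q` with `Δq = div w`, `∂q/∂n = w · n` on the
wall; the Euler pressure, `Δp = −tr(∇u∇u)`, `∂p/∂n = |u_θ|²` (Ferrari 1993, (10)–(12); the tree's
`Ferrari1993PressureNeumannProblem.lean`) — whose a-priori `H³` estimate for *smooth* solutions the tree
has (`periodicCylinder_neumannEstimate`, `Ferrari1993PressureEstimateProofs.lean`), but whose
**solvability** it has not. This file lays the Hilbert-space ground floor of that solvability, by
H. Weyl's method of orthogonal projection, on the period cell `cell = {r < 1} × (0, L)`: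

* `PeriodicCylinder.toCell L f` — the class of a function in `L²(cell)` (`Lp F 2 (volume.restrict cell)`,
  Mathlib's Hilbert space `L²`), with its algebra for square-integrable functions and the formula
  `⟪[f], [g]⟫ = ∫_cell ⟪f, g⟫`;
* `PeriodicCylinder.IsSmoothPeriodic L f` — `C^∞` on the closed cylinder `{r ≤ 1}` and `L`-periodic in
  `z` (the time slices of the tree's class `IsPeriodicCylinderEulerSolution`; the smooth functions of the
  compact flat manifold with boundary `{r ≤ 1} × ℝ/Lℤ`);
* `PeriodicCylinder.gradRange L` ⊂ `PeriodicCylinder.gradSpace L = 𝓖` — the classes `[∇_K q]` of the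
  gradients (within the closed cylinder, `cylGrad`) of smooth periodic `q`, and their `L²` closure, a
  closed (`isClosed_gradSpace`) hence complete subspace of `L²(cell; ℝ³)`; **periodicity in `z` and the
  Neumann (natural) boundary behaviour are encoded in the class of potentials**, not in the cell;
* `PeriodicCylinder.helmholtzProj L = Q` (orthogonal projection onto `𝓖`) and
  `PeriodicCylinder.lerayProj L = P` (onto `𝓖ᗮ`), `P + Q = 1` (`lerayProj_add_helmholtzProj`), with
  `v ∈ 𝓖ᗮ ↔ ∫_cell ⟪v, ∇q⟫ = 0` for all smooth periodic `q` (`mem_gradSpace_orthogonal_iff`: weakly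
  divergence free in the cylinder, weakly tangential on the wall, periodic), and **`P w = w` for every
  smooth periodic field divergence free in `{r < 1}` and tangential on `{r = 1}`**
  (`lerayProj_toCell_eq_self`, by the Gauss–Green theorem of the cell,
  `setIntegral_mul_divergence_add_fderiv_eq_zero`: wall flux zero by the slip condition, end fluxes
  cancelling by periodicity) — Kato–Lai's `u = Pu` for `u ∈ H_σ`, and the initial condition `Qφ = 0` of
  their `‖Qu(t)‖₀ = 0` argument;
* **potentials** — every `G ∈ 𝓖` is the weak gradient on the open cell of a unique mean-zero
  `p ∈ L²(cell)` (`exists_mem_potentialGraphClosure`, `fst_unique_of_mem_potentialGraphClosure`,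
  `hasWeakFDerivOn_potential` in the tree's sense `HasWeakFDerivOn`), depending linearly and continuously
  on `G` (`potentialL`, `‖pot G‖ ≤ C_P ‖G‖`, `norm_potential_le`): the graph `([q − ⨍q], [∇_K q])` of the
  smooth periodic functions (`potentialGraph`) has `L²`-closed graph closure on which the Poincaré–Wirtinger
  inequality of the cell (the tree's `exists_cellL2_sub_average_le`, constant `cellPoincareConst L`), the
  zero mean and the integration-by-parts identity against test functions persist (closed conditions);
* **weak solutions of the periodic Neumann problem** with data `h₀ ∈ L²(cell)`, `h₁ ∈ L²(cell; ℝ³)` —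
  `Δq = div h₁ − h₀` in the cylinder, `∂q/∂n = h₁ · n` on the wall, `q` periodic: the gradient
  `∇q = PeriodicCylinder.neumannGrad L h₀ h₁ ∈ 𝓖` is the Riesz representative
  (`InnerProductSpace.toDual`) of the data functional `∇ψ ↦ ⟪h₀, pot ∇ψ⟫ + ⟪h₁, ∇ψ⟫` — on `𝓖` the
  Dirichlet form *is* the inner product, so Lax–Milgram is Riesz —, unique
  (`eq_neumannGrad_of_forall_inner`), with `‖∇q‖ ≤ C_P ‖h₀‖ + ‖h₁‖` (`norm_neumannGrad_le`),
  `∇q = Q h₁` when `h₀ = 0` (`coe_neumannGrad_zero_left`), and, for `∫_cell h₀ = 0`, the tested form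
  `∫_cell ⟪∇q, ∇ψ⟫ = ∫_cell h₀ ψ + ∫_cell ⟪h₁, ∇ψ⟫` for all smooth periodic `ψ`
  (`setIntegral_inner_neumannGrad_cylGrad`).

Everything here is standard Hilbert-space theory (Weyl 1940; Galdi, *An Introduction to the
Mathematical Theory of the Navier–Stokes Equations*, Ch. III; Sohr, *The Navier–Stokes Equations*,
Ch. II §2.5; Temam, *Navier–Stokes Equations and Nonlinear Functional Analysis*, Rem. 1.6 for the
periodic case) specialised to the concrete cell of the tree; the regularity of these weak solutions
(tangential difference quotients along the Killing fields `∂_θ`, `∂_z`, normal derivatives from the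
equation, interior regularity), which turns `Q` into Kato–Lai's bounded operator on `H^s` and produces
the smooth Neumann solutions for smooth data that the tree's a-priori estimates presuppose, is the
subject of the sequel files.

## Design

* The Hilbert-space carrier is Mathlib's `Lp ℝ³ 2 (volume.restrict cell)`; all spaces are
  `Submodule`s of it (or of its product with `Lp ℝ 2 _`), closedness by `Submodule.topologicalClosure`,
  projections by `Submodule.starProjection`, so that completeness, `HasOrthogonalProjection`, `P + Q = 1`,
  `‖P‖ ≤ 1` and the Riesz map come from Mathlib with no proof obligation.
* No density theorem (`H¹ = ` closure of smooth periodic functions) is claimed or needed: `𝓖` is *defined*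
  as a closure, and every consumer of the theory (restrictions to the cylinder of smooth or Sobolev
  functions on a torus, smooth Euler data) lands in these closures by construction.
* `toCell` is total (junk `0` off `L²`), `potential`/`potentialL` are total (junk `0` for `L ≤ 0`).

## What is NOT here

Regularity of weak solutions; the identification of `𝓖ᗮ` with the `L²` closure of smooth solenoidal
tangential fields (Kato–Lai's definition of `H_σ` as a closure, §2 p. 16 — only the inclusion
`lerayProj_toCell_eq_self` is proved, which is what the Euler programme uses); the symmetry actions
(rotations about the axis, axial translations) on these spaces.

Mathlib/tree search: Mathlib has no Helmholtz/Leray projection on a domain (`lean search 'leray|helmholtz'`: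
the tree's `LerayProjector.lean`, `TorusLeray*` are Fourier-side on `T^d`/`ℝ^d`; `energySpace` of
`TorusSobolevSpace.lean` is the torus `L²_σ`); no weak Neumann problem on a domain (`lean search
'neumann'`: the cylinder a-priori estimates `PeriodicCylinderNeumann{Tangential,Gradient,FrameWords,WallWords}`,
`Ferrari1993Pressure*`, all for smooth solutions). Used from the tree: `cylGrad`, `cylDeriv_*`,
`inner_cylGrad_left`, `cylDeriv_eq_fderiv`, `setIntegral_mul_divergence_add_fderiv_eq_zero`
(`PeriodicCylinderWithinCalculus`), `exists_cellL2_sub_average_le`, `cylGrad_sub_const`, `cellL2`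
(`PeriodicCylinderNeumannGradient`, `PeriodicCylinderNeumannTangential`), `memLp_two_cylinderCell_of_continuousOn`,
`aestronglyMeasurable_cylinderCell_of_continuousOn` (`Ferrari1993EnergyIdentity`),
`integrableOn_cylinderCell_of_continuousOn_K`, `isBounded_cylinderCell`, `MeyersSerrin.hasWeakFDerivOn_of_contDiffOn`,
`HasWeakFDerivOn`, `IsTestFunctionOn` (`SobolevDomain`). From Mathlib: `MemLp.toLp`, `L2.inner_def`,
`Submodule.topologicalClosure` (`.completeSpace`, `_coe`), `Submodule.orthogonal_orthogonal_eq_closure`,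
`Submodule.triorthogonal_eq_orthogonal`, `Submodule.starProjection` (`_add_starProjection_orthogonal`,
`_eq_self_iff`, `_apply_eq_zero_iff`, `inner_starProjection_left_eq_right`, `norm_starProjection_apply_le`),
`Submodule.inf_orthogonal_eq_bot`, `InnerProductSpace.toDual` (`toDual_symm_apply`), `LinearMap.mkContinuous`,
`mem_closure_iff_seq_limit`, `cauchySeq_tendsto_of_complete`, `setAverage_sub_setAverage`, `innerSL`.

## References

* T. Kato, C. Y. Lai, *Nonlinear evolution equations and the Euler flow*, J. Funct. Anal. 56 (1984)
  15–28, §2 (p. 16: `P`, `H⁰_σ`), §4 (i) and (4.10), §5 (pp. 20–23). [KatoLai1984]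
* A. B. Ferrari, *On the blow-up of solutions of the 3-D Euler equations in a bounded domain*, Comm.
  Math. Phys. 155 (1993) 277–294, Lemma 2, (10)–(12) (the Neumann problem of the pressure). [Ferrari1993]
* G. P. Galdi, *An Introduction to the Mathematical Theory of the Navier–Stokes Equations*, 2nd ed.,
  Springer 2011, Ch. III (the Helmholtz–Weyl decomposition). [Galdi2011]
* H. Sohr, *The Navier–Stokes Equations*, Birkhäuser 2001, Ch. II §2.5 (the Helmholtz projection).
  [Sohr2001]
* R. Temam, *Navier–Stokes Equations and Nonlinear Functional Analysis*, 2nd ed., SIAM 1995, Ch. I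
  Rem. 1.6 (the periodic case). [TemamNSNFA1995]
-/

noncomputable section

open MeasureTheory Set Function Filter Topology TopologicalSpace WithLp Metric
open scoped ContDiff NNReal ENNReal InnerProductSpace RealInnerProductSpace

namespace Literature.Analysis.FluidPDE

open Literature.Analysis.FunctionSpaces

/-- Local notation for physical space `ℝ³ = EuclideanSpace ℝ (Fin 3)`. -/
local notation "ℝ³" => EuclideanSpace ℝ (Fin 3)

/-- Local notation for the closed unit cylinder `{r ≤ 1}`. -/
local notation "𝕂" => closure (SetLike.coe unitCylinder : Set (EuclideanSpace ℝ (Fin 3)))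

namespace PeriodicCylinder

/-! ### The cell measure and cell classes -/

/-- Lebesgue measure restricted to the open period cell `{r < 1} × (0, L)`. [folklore] -/
abbrev cellMeasure (L : ℝ) : Measure ℝ³ := volume.restrict (cylinderCell L : Set ℝ³)

/-- The period cell has finite volume. [folklore] -/
instance (L : ℝ) : IsFiniteMeasure (cellMeasure L) :=
  isFiniteMeasure_restrict.2 (isBounded_cylinderCell L).measure_lt_top.ne

section ToCell

variable {F : Type*} [NormedAddCommGroup F]

open Classical in
/-- The class in `L²(cell)` of a function on `ℝ³` (the junk value `0` if the function is not
square integrable on the cell). [folklore] -/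
def toCell (L : ℝ) (f : ℝ³ → F) : Lp F 2 (cellMeasure L) :=
  if hf : MemLp f 2 (cellMeasure L) then hf.toLp f else 0

variable {L : ℝ}

/-- `toCell` of a square-integrable function is its `L²` class. [folklore] -/
theorem toCell_eq_toLp {f : ℝ³ → F} (hf : MemLp f 2 (cellMeasure L)) : toCell L f = hf.toLp f :=
  dif_pos hf

/-- The cell class of a square-integrable function agrees with it a.e. on the cell. [folklore] -/
theorem coeFn_toCell {f : ℝ³ → F} (hf : MemLp f 2 (cellMeasure L)) : toCell L f =ᵐ[cellMeasure L] f := by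
  rw [toCell_eq_toLp hf]
  exact hf.coeFn_toLp

/-- The norm of a cell class is the `L²(cell)` norm. [folklore] -/
theorem norm_toCell {f : ℝ³ → F} (hf : MemLp f 2 (cellMeasure L)) :
    ‖toCell L f‖ = (eLpNorm f 2 (cellMeasure L)).toReal := by
  rw [toCell_eq_toLp hf, Lp.norm_toLp]

/-- For functions continuous on the closed cylinder, `‖toCell f‖ = cellL2 f`. [folklore] -/
theorem norm_toCell_eq_cellL2 {f : ℝ³ → F} (hf : ContinuousOn f 𝕂) :
    ‖toCell L f‖ = cellL2 L f := by
  rw [norm_toCell (memLp_two_cylinderCell_of_continuousOn L hf)]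
  rfl

/-- `toCell` is additive on square-integrable functions. [folklore] -/
theorem toCell_add {f g : ℝ³ → F} (hf : MemLp f 2 (cellMeasure L)) (hg : MemLp g 2 (cellMeasure L)) :
    toCell L (fun x => f x + g x) = toCell L f + toCell L g := by
  rw [toCell_eq_toLp hf, toCell_eq_toLp hg, ← MemLp.toLp_add hf hg]
  exact toCell_eq_toLp (hf.add hg)

/-- `toCell` respects subtraction of square-integrable functions. [folklore] -/
theorem toCell_sub {f g : ℝ³ → F} (hf : MemLp f 2 (cellMeasure L)) (hg : MemLp g 2 (cellMeasure L)) :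
    toCell L (fun x => f x - g x) = toCell L f - toCell L g := by
  rw [toCell_eq_toLp hf, toCell_eq_toLp hg, ← MemLp.toLp_sub hf hg]
  exact toCell_eq_toLp (hf.sub hg)

/-- `toCell` commutes with scalar multiplication. [folklore] -/
theorem toCell_const_smul [NormedSpace ℝ F] {f : ℝ³ → F} (c : ℝ) (hf : MemLp f 2 (cellMeasure L)) :
    toCell L (fun x => c • f x) = c • toCell L f := by
  rw [toCell_eq_toLp hf, ← MemLp.toLp_const_smul c hf]
  exact toCell_eq_toLp (hf.const_smul c)

/-- The cell class of the zero function is zero. [folklore] -/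
theorem toCell_zero : toCell L (fun _ : ℝ³ => (0 : F)) = 0 := by
  have h0 : MemLp (fun _ : ℝ³ => (0 : F)) 2 (cellMeasure L) := MemLp.zero'
  rw [toCell_eq_toLp h0]
  exact MemLp.toLp_zero h0

/-- Functions which agree on the open cell have the same cell class. [folklore] -/
theorem toCell_congr {f g : ℝ³ → F} (h : ∀ x ∈ (cylinderCell L : Set ℝ³), f x = g x) :
    toCell L f = toCell L g := by
  have hae : f =ᵐ[cellMeasure L] g :=
    (ae_restrict_mem (cylinderCell L).isOpen.measurableSet).mono fun x hx => h x hx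
  by_cases hf : MemLp f 2 (cellMeasure L)
  · have hg : MemLp g 2 (cellMeasure L) := hf.ae_eq hae
    rw [toCell_eq_toLp hf, toCell_eq_toLp hg]
    exact (MemLp.toLp_eq_toLp_iff hf hg).2 hae
  · have hg : ¬ MemLp g 2 (cellMeasure L) := fun hg => hf (hg.ae_eq hae.symm)
    simp [toCell, hf, hg]

/-- The `L²(cell)` inner product of the classes of two functions continuous on the closed
cylinder is the integral of their pointwise inner product over the cell. [folklore] -/
theorem inner_toCell_toCell {G : Type*} [NormedAddCommGroup G] [InnerProductSpace ℝ G]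
    {f g : ℝ³ → G} (hf : MemLp f 2 (cellMeasure L)) (hg : MemLp g 2 (cellMeasure L)) :
    ⟪toCell L f, toCell L g⟫ = ∫ x in (cylinderCell L : Set ℝ³), ⟪f x, g x⟫ := by
  rw [L2.inner_def]
  refine integral_congr_ae ?_
  filter_upwards [coeFn_toCell hf, coeFn_toCell hg] with x hx hy
  rw [hx, hy]

/-- The inner product of a class with the class of a function: a.e. formula. [folklore] -/
theorem inner_toCell_right {G : Type*} [NormedAddCommGroup G] [InnerProductSpace ℝ G]
    (v : Lp G 2 (cellMeasure L)) {g : ℝ³ → G} (hg : MemLp g 2 (cellMeasure L)) :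
    ⟪v, toCell L g⟫ = ∫ x in (cylinderCell L : Set ℝ³), ⟪v x, g x⟫ := by
  rw [L2.inner_def]
  refine integral_congr_ae ?_
  filter_upwards [coeFn_toCell hg] with x hx
  rw [hx]

end ToCell

/-! ### Smooth periodic functions on the closed cylinder -/

variable {F : Type*} [NormedAddCommGroup F] [NormedSpace ℝ F] {L : ℝ}

/-- **Smooth `L`-periodic functions on the closed cylinder**: `C^∞` on `{r ≤ 1}` (derivatives
within the closed cylinder) and `L`-periodic in `z` — the time slices of the tree's smooth periodic
Euler class `IsPeriodicCylinderEulerSolution`, and the smooth functions on the compact flat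
manifold with boundary `{r ≤ 1} × ℝ/Lℤ`. [folklore] -/
structure IsSmoothPeriodic (L : ℝ) (f : ℝ³ → F) : Prop where
  /-- Smooth on the closed cylinder. -/
  smooth : ContDiffOn ℝ ∞ f 𝕂
  /-- `L`-periodic in the axial variable. -/
  periodic : IsAxiallyPeriodic L f

namespace IsSmoothPeriodic

variable {f g : ℝ³ → F}

/-- Smooth periodic functions are continuous on the closed cylinder. [folklore] -/
theorem continuousOn (hf : IsSmoothPeriodic L f) : ContinuousOn f 𝕂 := hf.smooth.continuousOn

/-- Smooth periodic functions are square integrable on the cell. [folklore] -/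
theorem memLp (hf : IsSmoothPeriodic L f) : MemLp f 2 (cellMeasure L) :=
  memLp_two_cylinderCell_of_continuousOn L hf.continuousOn

/-- Sums of smooth periodic functions are smooth periodic. [folklore] -/
theorem add (hf : IsSmoothPeriodic L f) (hg : IsSmoothPeriodic L g) :
    IsSmoothPeriodic L (fun x => f x + g x) :=
  ⟨hf.smooth.add hg.smooth, fun x => by simp only [hf.periodic x, hg.periodic x]⟩

/-- Differences of smooth periodic functions are smooth periodic. [folklore] -/
theorem sub (hf : IsSmoothPeriodic L f) (hg : IsSmoothPeriodic L g) :
    IsSmoothPeriodic L (fun x => f x - g x) :=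
  ⟨hf.smooth.sub hg.smooth, fun x => by simp only [hf.periodic x, hg.periodic x]⟩

/-- Negatives of smooth periodic functions are smooth periodic. [folklore] -/
theorem neg (hf : IsSmoothPeriodic L f) : IsSmoothPeriodic L (fun x => -f x) :=
  ⟨hf.smooth.neg, fun x => by simp only [hf.periodic x]⟩

/-- Scalar multiples of smooth periodic functions are smooth periodic. [folklore] -/
theorem const_smul (hf : IsSmoothPeriodic L f) (c : ℝ) : IsSmoothPeriodic L (fun x => c • f x) :=
  ⟨hf.smooth.const_smul c, fun x => by simp only [hf.periodic x]⟩

/-- Constants are smooth periodic. [folklore] -/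
theorem _root_.Literature.Analysis.FluidPDE.PeriodicCylinder.isSmoothPeriodic_const (c : F) :
    IsSmoothPeriodic L (fun _ : ℝ³ => c) :=
  ⟨contDiffOn_const, fun _ => rfl⟩

/-- A smooth periodic function minus a constant is smooth periodic. [folklore] -/
theorem sub_const (hf : IsSmoothPeriodic L f) (c : F) : IsSmoothPeriodic L (fun x => f x - c) :=
  hf.sub (isSmoothPeriodic_const c)

/-- The gradient within the closed cylinder of a smooth periodic function is smooth periodic. [folklore] -/
theorem cylGrad {q : ℝ³ → ℝ} (hq : IsSmoothPeriodic L q) : IsSmoothPeriodic L (cylGrad q) :=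
  ⟨contDiffOn_cylGrad hq.smooth, hq.periodic.cylGrad⟩

end IsSmoothPeriodic

/-- `∇_K (q₁ + q₂) = ∇_K q₁ + ∇_K q₂` on the closed cylinder. [folklore] -/
theorem cylGrad_add {q₁ q₂ : ℝ³ → ℝ} (h₁ : ContDiffOn ℝ ∞ q₁ 𝕂) (h₂ : ContDiffOn ℝ ∞ q₂ 𝕂) {x : ℝ³}
    (hx : x ∈ 𝕂) : cylGrad (fun y => q₁ y + q₂ y) x = cylGrad q₁ x + cylGrad q₂ x := by
  simp only [cylGrad_apply, cylDeriv_add h₁ h₂ hx, add_smul, Finset.sum_add_distrib]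

/-- `∇_K (c q) = c ∇_K q` on the closed cylinder. [folklore] -/
theorem cylGrad_const_smul (c : ℝ) {q : ℝ³ → ℝ} (h : ContDiffOn ℝ ∞ q 𝕂) {x : ℝ³} (hx : x ∈ 𝕂) :
    cylGrad (fun y => c • q y) x = c • cylGrad q x := by
  rw [cylGrad_apply, cylGrad_apply, Finset.smul_sum]
  refine Finset.sum_congr rfl fun i _ => ?_
  rw [cylDeriv_const_smul c h hx, smul_eq_mul, mul_smul]

/-- `∇_K` of a constant vanishes. [folklore] -/
theorem cylGrad_const (c : ℝ) (x : ℝ³) : cylGrad (fun _ : ℝ³ => c) x = 0 := by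
  simp [cylGrad_apply, cylDeriv_const]

/-- The open cell lies in the closed cylinder. [folklore] -/
theorem cell_subset_K : (cylinderCell L : Set ℝ³) ⊆ 𝕂 :=
  fun _ hx => subset_closure (cylinderCell_le_unitCylinder L hx)

/-! ### The space of gradients and the Helmholtz–Weyl decomposition -/

variable (L) in
/-- **Gradients of smooth periodic functions**, as a subspace of `L²(cell; ℝ³)`: the classes of
`∇q` for `q` smooth on the closed cylinder and `L`-periodic. [folklore] -/
def gradRange : Submodule ℝ (Lp ℝ³ 2 (cellMeasure L)) where
  carrier := {G | ∃ q : ℝ³ → ℝ, IsSmoothPeriodic L q ∧ G = toCell L (cylGrad q)}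
  add_mem' := by
    rintro _ _ ⟨q₁, hq₁, rfl⟩ ⟨q₂, hq₂, rfl⟩
    refine ⟨fun y => q₁ y + q₂ y, hq₁.add hq₂, ?_⟩
    rw [← toCell_add hq₁.cylGrad.memLp hq₂.cylGrad.memLp]
    exact toCell_congr fun x hx => (cylGrad_add hq₁.smooth hq₂.smooth (cell_subset_K hx)).symm
  zero_mem' := ⟨fun _ => 0, isSmoothPeriodic_const 0, by
    rw [← toCell_zero (L := L) (F := ℝ³)]
    exact toCell_congr fun x _ => (cylGrad_const 0 x).symm⟩
  smul_mem' := by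
    rintro c _ ⟨q, hq, rfl⟩
    refine ⟨fun y => c • q y, hq.const_smul c, ?_⟩
    rw [← toCell_const_smul c hq.cylGrad.memLp]
    exact toCell_congr fun x hx => (cylGrad_const_smul c hq.smooth (cell_subset_K hx)).symm

/-- The class of the gradient of a smooth periodic function is a smooth gradient. [folklore] -/
theorem toCell_cylGrad_mem_gradRange {q : ℝ³ → ℝ} (hq : IsSmoothPeriodic L q) :
    toCell L (cylGrad q) ∈ gradRange L := ⟨q, hq, rfl⟩

variable (L) in
/-- **The space of `L²` gradients** `𝓖 ⊂ L²(cell; ℝ³)`: the `L²` closure of the gradients of smooth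
periodic functions (H. Weyl 1940, the method of orthogonal projection; Temam, *Navier–Stokes
Equations*, Ch. I Thm 1.4 / Rem. 1.6 for the periodic case: `L² = H ⊕ G`, `G` the closure of
gradients). A closed subspace of a Hilbert space, hence complete with an orthogonal projection.
[folklore] -/
def gradSpace : Submodule ℝ (Lp ℝ³ 2 (cellMeasure L)) := (gradRange L).topologicalClosure

/-- Smooth gradients are `L²` gradients. [folklore] -/
theorem gradRange_le_gradSpace : gradRange L ≤ gradSpace L := (gradRange L).le_topologicalClosure

/-- The space of `L²` gradients is closed. [folklore] -/
theorem isClosed_gradSpace : IsClosed (gradSpace L : Set (Lp ℝ³ 2 (cellMeasure L))) :=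
  (gradRange L).isClosed_topologicalClosure

/-- The space of `L²` gradients is complete (a closed subspace of a Hilbert space). [folklore] -/
instance : CompleteSpace (gradSpace L) := Submodule.topologicalClosure.completeSpace _

/-- The space of `L²` gradients is the closure of the smooth gradients. [folklore] -/
theorem coe_gradSpace : (gradSpace L : Set (Lp ℝ³ 2 (cellMeasure L))) = closure (gradRange L) :=
  (gradRange L).topologicalClosure_coe

/-- The orthogonal complement of the space of gradients is that of the smooth gradients. [folklore] -/
theorem gradSpace_orthogonal_eq : (gradSpace L)ᗮ = (gradRange L)ᗮ := by
  rw [gradSpace, ← Submodule.orthogonal_orthogonal_eq_closure, Submodule.triorthogonal_eq_orthogonal]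

/-- **Weakly solenoidal, weakly tangential fields**: `v ⊥ 𝓖` iff `∫_cell ⟪v, ∇q⟫ = 0` for every smooth
periodic `q` (the weak form of `div v = 0` in the cylinder, `v · n = 0` on the wall, with periodic
test functions). [folklore] -/
theorem mem_gradSpace_orthogonal_iff {v : Lp ℝ³ 2 (cellMeasure L)} :
    v ∈ (gradSpace L)ᗮ ↔ ∀ q : ℝ³ → ℝ, IsSmoothPeriodic L q →
      ∫ x in (cylinderCell L : Set ℝ³), ⟪v x, cylGrad q x⟫ = 0 := by
  rw [gradSpace_orthogonal_eq, Submodule.mem_orthogonal']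
  constructor
  · intro h q hq
    rw [← inner_toCell_right v hq.cylGrad.memLp]
    exact h _ (toCell_cylGrad_mem_gradRange hq)
  · rintro h _ ⟨q, hq, rfl⟩
    rw [inner_toCell_right v hq.cylGrad.memLp]
    exact h q hq

variable (L) in
/-- **The Helmholtz projection onto gradients** `Q : L²(cell; ℝ³) → 𝓖` (orthogonal projection;
Kato–Lai 1984 §2/§4: `Q = 1 − P`). [folklore] -/
def helmholtzProj : Lp ℝ³ 2 (cellMeasure L) →L[ℝ] Lp ℝ³ 2 (cellMeasure L) := (gradSpace L).starProjection

variable (L) in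
/-- **The Leray projection** `P : L²(cell; ℝ³) → 𝓖ᗮ` onto the weakly solenoidal, weakly tangential
fields (Kato–Lai 1984 §2: "`P` denotes the orthogonal projection of `H⁰(Ω; ℝᵐ) = L²(Ω; ℝᵐ)` onto the
subspace `H⁰_σ` of solenoidal vectors"; here on the period cell of the periodic cylinder, with
periodicity built into the class of potentials). [folklore] -/
def lerayProj : Lp ℝ³ 2 (cellMeasure L) →L[ℝ] Lp ℝ³ 2 (cellMeasure L) := (gradSpace L)ᗮ.starProjection

/-- Unfolding the Helmholtz projection. [folklore] -/
theorem helmholtzProj_apply (v : Lp ℝ³ 2 (cellMeasure L)) :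
    helmholtzProj L v = (gradSpace L).starProjection v := rfl

/-- Unfolding the Leray projection. [folklore] -/
theorem lerayProj_apply (v : Lp ℝ³ 2 (cellMeasure L)) :
    lerayProj L v = (gradSpace L)ᗮ.starProjection v := rfl

/-- **Helmholtz–Weyl decomposition** `v = P v + Q v`. [folklore] -/
theorem lerayProj_add_helmholtzProj (v : Lp ℝ³ 2 (cellMeasure L)) :
    lerayProj L v + helmholtzProj L v = v := by
  rw [lerayProj_apply, helmholtzProj_apply, add_comm]
  exact Submodule.starProjection_add_starProjection_orthogonal (K := gradSpace L) v

/-- `Q v` is an `L²` gradient. [folklore] -/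
theorem helmholtzProj_mem (v : Lp ℝ³ 2 (cellMeasure L)) : helmholtzProj L v ∈ gradSpace L :=
  Submodule.starProjection_apply_mem _ v

/-- `P v` is orthogonal to the `L²` gradients. [folklore] -/
theorem lerayProj_mem (v : Lp ℝ³ 2 (cellMeasure L)) : lerayProj L v ∈ (gradSpace L)ᗮ :=
  Submodule.starProjection_apply_mem _ v

/-- `P v = v` iff `v ⊥ 𝓖`. [folklore] -/
theorem lerayProj_eq_self_iff {v : Lp ℝ³ 2 (cellMeasure L)} : lerayProj L v = v ↔ v ∈ (gradSpace L)ᗮ :=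
  Submodule.starProjection_eq_self_iff

/-- `Q v = v` iff `v ∈ 𝓖`. [folklore] -/
theorem helmholtzProj_eq_self_iff {v : Lp ℝ³ 2 (cellMeasure L)} :
    helmholtzProj L v = v ↔ v ∈ gradSpace L :=
  Submodule.starProjection_eq_self_iff

/-- `Q v = 0` iff `v ⊥ 𝓖`. [folklore] -/
theorem helmholtzProj_eq_zero_iff {v : Lp ℝ³ 2 (cellMeasure L)} :
    helmholtzProj L v = 0 ↔ v ∈ (gradSpace L)ᗮ := by
  rw [helmholtzProj_apply, Submodule.starProjection_apply_eq_zero_iff]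

/-- `‖P v‖ ≤ ‖v‖`. [folklore] -/
theorem norm_lerayProj_le (v : Lp ℝ³ 2 (cellMeasure L)) : ‖lerayProj L v‖ ≤ ‖v‖ :=
  Submodule.norm_starProjection_apply_le _ v

/-- `‖Q v‖ ≤ ‖v‖`. [folklore] -/
theorem norm_helmholtzProj_le (v : Lp ℝ³ 2 (cellMeasure L)) : ‖helmholtzProj L v‖ ≤ ‖v‖ :=
  Submodule.norm_starProjection_apply_le _ v

/-! ### Smooth solenoidal tangential fields are their own Leray projection -/

/-- **A smooth periodic field, divergence free in the cylinder and tangential on the wall, is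
orthogonal to all gradients** (Gauss–Green on the period cell: `∫_cell ⟪w, ∇q⟫ = −∫_cell q div w = 0`,
the wall flux vanishing by the slip condition and the end fluxes cancelling by periodicity).
[folklore] -/
theorem toCell_mem_gradSpace_orthogonal (hL : 0 < L) {w : ℝ³ → ℝ³} (hw : IsSmoothPeriodic L w)
    (hdiv : ∀ x ∈ (unitCylinder : Set ℝ³), VectorCalculus.divergence w x = 0)
    (hslip : ∀ x ∈ frontier (unitCylinder : Set ℝ³), ⟪w x, eR x⟫ = 0) :
    toCell L w ∈ (gradSpace L)ᗮ := by
  rw [mem_gradSpace_orthogonal_iff]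
  intro q hq
  have h := setIntegral_mul_divergence_add_fderiv_eq_zero hL
    (hq.smooth.of_le (by exact_mod_cast le_top)) (hw.smooth.of_le (by exact_mod_cast le_top))
    hslip hq.periodic hw.periodic
  rw [← h]
  refine integral_congr_ae ?_
  filter_upwards [coeFn_toCell hw.memLp, ae_restrict_mem (cylinderCell L).isOpen.measurableSet]
    with x hx hxc
  have hxU : x ∈ (unitCylinder : Set ℝ³) := cylinderCell_le_unitCylinder L hxc
  rw [hx, hdiv x hxU, mul_zero, zero_add, real_inner_comm, inner_cylGrad_left,
    ← cylDeriv_eq_fderiv w q hxU, cylDeriv_apply]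

/-- Hence `P w = w` and `Q w = 0` for such fields (Kato–Lai 1984 §2: `u = Pu` for `u ∈ H_σ`). [folklore] -/
theorem lerayProj_toCell_eq_self (hL : 0 < L) {w : ℝ³ → ℝ³} (hw : IsSmoothPeriodic L w)
    (hdiv : ∀ x ∈ (unitCylinder : Set ℝ³), VectorCalculus.divergence w x = 0)
    (hslip : ∀ x ∈ frontier (unitCylinder : Set ℝ³), ⟪w x, eR x⟫ = 0) :
    lerayProj L (toCell L w) = toCell L w :=
  lerayProj_eq_self_iff.2 (toCell_mem_gradSpace_orthogonal hL hw hdiv hslip)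

/-- `Q w = 0` for a smooth periodic field that is divergence free in the cylinder and tangential on the
wall. [folklore] -/
theorem helmholtzProj_toCell_eq_zero (hL : 0 < L) {w : ℝ³ → ℝ³} (hw : IsSmoothPeriodic L w)
    (hdiv : ∀ x ∈ (unitCylinder : Set ℝ³), VectorCalculus.divergence w x = 0)
    (hslip : ∀ x ∈ frontier (unitCylinder : Set ℝ³), ⟪w x, eR x⟫ = 0) :
    helmholtzProj L (toCell L w) = 0 :=
  helmholtzProj_eq_zero_iff.2 (toCell_mem_gradSpace_orthogonal hL hw hdiv hslip)

/-! ### The Poincaré constant of the period cell -/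

variable (L) in
/-- **A Poincaré–Wirtinger constant of the period cell**: a constant `C_P ≥ 0` with
`‖f − ⨍_cell f‖_{L²(cell)} ≤ C_P ‖∇_K f‖_{L²(cell)}` for all `f` smooth on the closed cylinder (the
tree's `exists_cellL2_sub_average_le`, from `poincare_starShaped` on the bounded convex cell);
`0` for `L ≤ 0` (junk). [folklore] -/
def cellPoincareConst : ℝ :=
  if h : 0 < L then Classical.choose (exists_cellL2_sub_average_le h) else 0

/-- The Poincaré constant is nonnegative. [folklore] -/
theorem cellPoincareConst_nonneg : 0 ≤ cellPoincareConst L := by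
  unfold cellPoincareConst
  split_ifs with h
  · exact (Classical.choose_spec (exists_cellL2_sub_average_le h)).1
  · exact le_rfl

/-- The Poincaré–Wirtinger inequality on the cell with the constant `cellPoincareConst L`. [folklore] -/
theorem cellL2_sub_average_le (hL : 0 < L) {f : ℝ³ → ℝ} (hf : ContDiffOn ℝ ∞ f 𝕂) :
    cellL2 L (fun x => f x - ⨍ y in (cylinderCell L : Set ℝ³), f y) ≤
      cellPoincareConst L * cellL2 L (cylGrad f) := by
  have h := (Classical.choose_spec (exists_cellL2_sub_average_le hL)).2 f hf
  unfold cellPoincareConst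
  rw [dif_pos hL]
  exact h

/-- The Poincaré–Wirtinger inequality on the cell, for cell classes. [folklore] -/
theorem norm_toCell_sub_average_le (hL : 0 < L) {q : ℝ³ → ℝ} (hq : ContDiffOn ℝ ∞ q 𝕂) :
    ‖toCell L (fun x => q x - ⨍ y in (cylinderCell L : Set ℝ³), q y)‖ ≤
      cellPoincareConst L * ‖toCell L (cylGrad q)‖ := by
  rw [norm_toCell_eq_cellL2 (f := fun x => q x - ⨍ y in (cylinderCell L : Set ℝ³), q y)
      (hq.continuousOn.sub continuousOn_const),
    norm_toCell_eq_cellL2 (contDiffOn_cylGrad hq).continuousOn]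
  exact cellL2_sub_average_le hL hq

/-- A smooth periodic function with zero mean on the cell equals itself minus its average. [folklore] -/
theorem sub_average_eq_self_of_integral_eq_zero {q : ℝ³ → ℝ}
    (h0 : ∫ x in (cylinderCell L : Set ℝ³), q x = 0) (x : ℝ³) :
    q x - ⨍ y in (cylinderCell L : Set ℝ³), q y = q x := by
  rw [setAverage_eq, h0, smul_zero, sub_zero]

/-! ### Potentials: every `L²` gradient is the weak gradient of a mean-zero `L²` function -/

variable (L) in
/-- **The graph of (mean-zero potential, gradient)** for smooth periodic functions: the pairs
`([q], [∇_K q])` in `L²(cell) × L²(cell; ℝ³)` with `q` smooth periodic of zero mean on the cell.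
[folklore] -/
def potentialGraph : Submodule ℝ (Lp ℝ 2 (cellMeasure L) × Lp ℝ³ 2 (cellMeasure L)) where
  carrier := {z | ∃ q : ℝ³ → ℝ, IsSmoothPeriodic L q ∧ ∫ x in (cylinderCell L : Set ℝ³), q x = 0 ∧
    z = (toCell L q, toCell L (cylGrad q))}
  add_mem' := by
    rintro _ _ ⟨q₁, hq₁, h₁, rfl⟩ ⟨q₂, hq₂, h₂, rfl⟩
    refine ⟨fun y => q₁ y + q₂ y, hq₁.add hq₂, ?_, ?_⟩
    · rw [integral_add (integrableOn_cylinderCell_of_continuousOn_K L hq₁.continuousOn)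
        (integrableOn_cylinderCell_of_continuousOn_K L hq₂.continuousOn), h₁, h₂, add_zero]
    · rw [Prod.mk_add_mk, ← toCell_add hq₁.memLp hq₂.memLp,
        ← toCell_add hq₁.cylGrad.memLp hq₂.cylGrad.memLp]
      congr 1
      exact toCell_congr fun x hx => (cylGrad_add hq₁.smooth hq₂.smooth (cell_subset_K hx)).symm
  zero_mem' := ⟨fun _ => 0, isSmoothPeriodic_const 0, by simp, by
    rw [Prod.zero_eq_mk, toCell_zero, ← toCell_zero (L := L) (F := ℝ³)]
    congr 1
    exact toCell_congr fun x _ => (cylGrad_const 0 x).symm⟩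
  smul_mem' := by
    rintro c _ ⟨q, hq, h0, rfl⟩
    refine ⟨fun y => c • q y, hq.const_smul c, ?_, ?_⟩
    · simp only [smul_eq_mul, integral_const_mul, h0, mul_zero]
    · rw [Prod.smul_mk, ← toCell_const_smul c hq.memLp, ← toCell_const_smul c hq.cylGrad.memLp]
      congr 1
      exact toCell_congr fun x hx => (cylGrad_const_smul c hq.smooth (cell_subset_K hx)).symm

variable (L) in
/-- The closure of the potential graph in `L²(cell) × L²(cell; ℝ³)`: the graph of the weak gradient on
mean-zero periodic `H¹` potentials (the `H¹` closure of the smooth periodic functions). [folklore] -/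
def potentialGraphClosure : Submodule ℝ (Lp ℝ 2 (cellMeasure L) × Lp ℝ³ 2 (cellMeasure L)) :=
  (potentialGraph L).topologicalClosure

/-- The potential graph lies in its closure. [folklore] -/
theorem potentialGraph_le_closure : potentialGraph L ≤ potentialGraphClosure L :=
  (potentialGraph L).le_topologicalClosure

/-- The closed potential graph is the closure of the potential graph. [folklore] -/
theorem coe_potentialGraphClosure :
    (potentialGraphClosure L : Set (Lp ℝ 2 (cellMeasure L) × Lp ℝ³ 2 (cellMeasure L))) =
      closure (potentialGraph L) :=
  (potentialGraph L).topologicalClosure_coe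

/-- The graph point of a smooth periodic function: `([q − ⨍q], [∇_K q])`. [folklore] -/
theorem mk_sub_average_mem_potentialGraph {q : ℝ³ → ℝ} (hq : IsSmoothPeriodic L q) :
    (toCell L (fun x => q x - ⨍ y in (cylinderCell L : Set ℝ³), q y), toCell L (cylGrad q)) ∈
      potentialGraph L := by
  refine ⟨fun x => q x - ⨍ y in (cylinderCell L : Set ℝ³), q y, hq.sub_const _, ?_, ?_⟩
  · exact setAverage_sub_setAverage (isBounded_cylinderCell L).measure_lt_top.ne q
  · rw [cylGrad_sub_const]

/-- **Poincaré on the graph**: `‖p‖ ≤ C_P ‖G‖` for `(p, G)` in the potential graph. [folklore] -/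
theorem norm_fst_le_of_mem_potentialGraph (hL : 0 < L)
    {z : Lp ℝ 2 (cellMeasure L) × Lp ℝ³ 2 (cellMeasure L)} (hz : z ∈ potentialGraph L) :
    ‖z.1‖ ≤ cellPoincareConst L * ‖z.2‖ := by
  obtain ⟨q, hq, h0, rfl⟩ := hz
  have h := norm_toCell_sub_average_le hL hq.smooth
  simp only [sub_average_eq_self_of_integral_eq_zero h0] at h
  exact h

/-- **Poincaré on the closed graph**: `‖p‖ ≤ C_P ‖G‖` for `(p, G)` in the closure of the potential
graph. [folklore] -/
theorem norm_fst_le_of_mem_potentialGraphClosure (hL : 0 < L)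
    {z : Lp ℝ 2 (cellMeasure L) × Lp ℝ³ 2 (cellMeasure L)} (hz : z ∈ potentialGraphClosure L) :
    ‖z.1‖ ≤ cellPoincareConst L * ‖z.2‖ := by
  set S : Set (Lp ℝ 2 (cellMeasure L) × Lp ℝ³ 2 (cellMeasure L)) :=
    {z | ‖z.1‖ ≤ cellPoincareConst L * ‖z.2‖} with hS
  have hcl : IsClosed S :=
    isClosed_le (continuous_norm.comp continuous_fst) (continuous_const.mul (continuous_norm.comp continuous_snd))
  have hsub : closure (potentialGraph L : Set (Lp ℝ 2 (cellMeasure L) × Lp ℝ³ 2 (cellMeasure L))) ⊆ S :=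
    closure_minimal (fun z hz => norm_fst_le_of_mem_potentialGraph hL hz) hcl
  rw [← SetLike.mem_coe, coe_potentialGraphClosure] at hz
  exact hsub hz

/-- **Mean zero on the closed graph**: `∫_cell p = 0` for `(p, G)` in the closure of the potential
graph (the mean is an `L²`-continuous functional on the finite cell). [folklore] -/
theorem inner_toCell_one_fst_eq_zero_of_mem_potentialGraphClosure
    {z : Lp ℝ 2 (cellMeasure L) × Lp ℝ³ 2 (cellMeasure L)} (hz : z ∈ potentialGraphClosure L) :
    ⟪toCell L (fun _ : ℝ³ => (1 : ℝ)), z.1⟫ = 0 := by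
  set S : Set (Lp ℝ 2 (cellMeasure L) × Lp ℝ³ 2 (cellMeasure L)) :=
    {z | ⟪toCell L (fun _ : ℝ³ => (1 : ℝ)), z.1⟫ = 0} with hS
  have hcl : IsClosed S := isClosed_eq (continuous_const.inner continuous_fst) continuous_const
  have hsub : closure (potentialGraph L : Set (Lp ℝ 2 (cellMeasure L) × Lp ℝ³ 2 (cellMeasure L))) ⊆ S := by
    refine closure_minimal ?_ hcl
    rintro _ ⟨q, hq, h0, rfl⟩
    show ⟪toCell L (fun _ : ℝ³ => (1 : ℝ)), toCell L q⟫ = 0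
    rw [inner_toCell_toCell (isSmoothPeriodic_const (L := L) (1 : ℝ)).memLp hq.memLp, ← h0]
    exact integral_congr_ae (Eventually.of_forall fun x => by simp)
  rw [← SetLike.mem_coe, coe_potentialGraphClosure] at hz
  exact hsub hz

/-- The integral over the cell of an `L²` class is its inner product with the class of `1`. [folklore] -/
theorem integral_eq_inner_toCell_one (p : Lp ℝ 2 (cellMeasure L)) :
    ∫ x in (cylinderCell L : Set ℝ³), p x = ⟪toCell L (fun _ : ℝ³ => (1 : ℝ)), p⟫ := by
  rw [real_inner_comm, inner_toCell_right p (isSmoothPeriodic_const (L := L) (1 : ℝ)).memLp]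
  exact integral_congr_ae (Eventually.of_forall fun x => by simp)

/-- A test function on the cell, and its directional derivatives, are square integrable on the cell.
[folklore] -/
theorem memLp_of_isTestFunctionOn {G : Type*} [NormedAddCommGroup G] [NormedSpace ℝ G] {φ : ℝ³ → G}
    (hφ : IsTestFunctionOn (cylinderCell L) φ) : MemLp φ 2 (cellMeasure L) :=
  memLp_two_cylinderCell_of_continuousOn L hφ.contDiff.continuous.continuousOn

/-- Directional derivatives of a test function on the cell are square integrable on the cell. [folklore] -/
theorem memLp_fderiv_of_isTestFunctionOn {φ : ℝ³ → ℝ} (hφ : IsTestFunctionOn (cylinderCell L) φ) (v : ℝ³) :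
    MemLp (fun x => fderiv ℝ φ x v) 2 (cellMeasure L) :=
  memLp_two_cylinderCell_of_continuousOn L
    ((hφ.contDiff.continuous_fderiv (by simp)).clm_apply continuous_const).continuousOn

/-- **Weak gradient on the closed graph**: for `(p, G)` in the closure of the potential graph, `G` is
the weak gradient of `p` on the open cell: `∫ (∂ᵥφ) p = −∫ φ ⟪G, v⟫` for every test function `φ` on the
cell (limit of the classical integration by parts for smooth potentials). [folklore] -/
theorem integral_fderiv_mul_fst_eq_of_mem_potentialGraphClosure
    {z : Lp ℝ 2 (cellMeasure L) × Lp ℝ³ 2 (cellMeasure L)} (hz : z ∈ potentialGraphClosure L)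
    {φ : ℝ³ → ℝ} (hφ : IsTestFunctionOn (cylinderCell L) φ) (v : ℝ³) :
    ∫ x in (cylinderCell L : Set ℝ³), fderiv ℝ φ x v * z.1 x =
      -∫ x in (cylinderCell L : Set ℝ³), φ x * ⟪z.2 x, v⟫ := by
  -- both sides are continuous in `z`
  set a : Lp ℝ 2 (cellMeasure L) := toCell L (fun x => fderiv ℝ φ x v) with ha
  set b : Lp ℝ³ 2 (cellMeasure L) := toCell L (fun x => φ x • v) with hb
  have hbm : MemLp (fun x => φ x • v) 2 (cellMeasure L) :=
    memLp_two_cylinderCell_of_continuousOn L (hφ.contDiff.continuous.smul continuous_const).continuousOn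
  have hlhs : ∀ w : Lp ℝ 2 (cellMeasure L) × Lp ℝ³ 2 (cellMeasure L),
      ∫ x in (cylinderCell L : Set ℝ³), fderiv ℝ φ x v * w.1 x = ⟪a, w.1⟫ := fun w => by
    rw [ha, real_inner_comm, inner_toCell_right w.1 (memLp_fderiv_of_isTestFunctionOn hφ v)]
    exact integral_congr_ae (Eventually.of_forall fun x => by simp [mul_comm])
  have hrhs : ∀ w : Lp ℝ 2 (cellMeasure L) × Lp ℝ³ 2 (cellMeasure L),
      ∫ x in (cylinderCell L : Set ℝ³), φ x * ⟪w.2 x, v⟫ = ⟪w.2, b⟫ := fun w => by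
    rw [hb, inner_toCell_right w.2 hbm]
    exact integral_congr_ae (Eventually.of_forall fun x => by simp [real_inner_smul_right])
  set S : Set (Lp ℝ 2 (cellMeasure L) × Lp ℝ³ 2 (cellMeasure L)) := {w | ⟪a, w.1⟫ = -⟪w.2, b⟫} with hS
  have hcl : IsClosed S :=
    isClosed_eq (continuous_const.inner continuous_fst) (continuous_snd.inner continuous_const).neg
  have hsub : closure (potentialGraph L : Set (Lp ℝ 2 (cellMeasure L) × Lp ℝ³ 2 (cellMeasure L))) ⊆ S := by
    refine closure_minimal ?_ hcl
    rintro _ ⟨q, hq, -, rfl⟩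
    show ⟪a, toCell L q⟫ = -⟪toCell L (cylGrad q), b⟫
    rw [← hlhs (toCell L q, toCell L (cylGrad q)), ← hrhs (toCell L q, toCell L (cylGrad q))]
    have hw := (MeyersSerrin.hasWeakFDerivOn_of_contDiffOn (μ := volume) (Ω := cylinderCell L)
      (hq.smooth.mono cell_subset_K)).integral_fderiv_smul_eq φ v hφ
    simp only [smul_eq_mul] at hw
    have h1 : ∫ x in (cylinderCell L : Set ℝ³), fderiv ℝ φ x v * (toCell L q : ℝ³ → ℝ) x =
        ∫ x in (cylinderCell L : Set ℝ³), fderiv ℝ φ x v * q x := by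
      refine integral_congr_ae ?_
      filter_upwards [coeFn_toCell hq.memLp] with x hx
      rw [hx]
    have h2 : ∫ x in (cylinderCell L : Set ℝ³), φ x * ⟪(toCell L (cylGrad q) : ℝ³ → ℝ³) x, v⟫ =
        ∫ x in (cylinderCell L : Set ℝ³), φ x * fderiv ℝ q x v := by
      refine integral_congr_ae ?_
      filter_upwards [coeFn_toCell hq.cylGrad.memLp,
        ae_restrict_mem (cylinderCell L).isOpen.measurableSet] with x hx hxc
      rw [hx, inner_cylGrad_left, ← cylDeriv_apply (fun _ => v) q x,
        cylDeriv_eq_fderiv _ _ (cylinderCell_le_unitCylinder L hxc)]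
    rw [h1, h2, hw]
  rw [← SetLike.mem_coe, coe_potentialGraphClosure] at hz
  have h := hsub hz
  rw [hS, mem_setOf_eq, ← hlhs z, ← hrhs z] at h
  exact h

/-- The same, packaged as a weak Fréchet derivative in the tree's sense: the first component of a point
of the closed graph lies in `H¹(cell)` with weak gradient the second component. [folklore] -/
theorem hasWeakFDerivOn_of_mem_potentialGraphClosure
    {z : Lp ℝ 2 (cellMeasure L) × Lp ℝ³ 2 (cellMeasure L)} (hz : z ∈ potentialGraphClosure L) :
    HasWeakFDerivOn (cylinderCell L) volume (z.1 : ℝ³ → ℝ)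
      (fun x => (innerSL ℝ ((z.2 : ℝ³ → ℝ³) x) : ℝ³ →L[ℝ] ℝ)) := by
  have hint1 : IntegrableOn (z.1 : ℝ³ → ℝ) (cylinderCell L : Set ℝ³) volume :=
    (Lp.memLp z.1).integrable one_le_two
  have hint2 : IntegrableOn (z.2 : ℝ³ → ℝ³) (cylinderCell L : Set ℝ³) volume :=
    (Lp.memLp z.2).integrable one_le_two
  have hmeas : AEStronglyMeasurable (fun x => (innerSL ℝ ((z.2 : ℝ³ → ℝ³) x) : ℝ³ →L[ℝ] ℝ))
      (cellMeasure L) :=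
    (innerSL ℝ (E := ℝ³)).continuous.comp_aestronglyMeasurable (Lp.aestronglyMeasurable z.2)
  have hint3 : IntegrableOn (fun x => (innerSL ℝ ((z.2 : ℝ³ → ℝ³) x) : ℝ³ →L[ℝ] ℝ))
      (cylinderCell L : Set ℝ³) volume :=
    Integrable.mono' hint2.norm hmeas (Eventually.of_forall fun x => (innerSL_apply_norm ℝ _).le)
  refine ⟨hint1.locallyIntegrableOn, hint3.locallyIntegrableOn, fun φ v hφ => ?_⟩
  have h := integral_fderiv_mul_fst_eq_of_mem_potentialGraphClosure hz hφ v
  simp only [smul_eq_mul, innerSL_apply_apply]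
  exact h

/-- **Every `L²` gradient has a potential**: for `G ∈ 𝓖` there is `p ∈ L²(cell)` with `(p, G)` in the
closed potential graph — the gradients `∇qₙ → G` of smooth periodic `qₙ`, normalised to zero mean, have
`L²`-Cauchy potentials by the Poincaré inequality. [folklore] -/
theorem exists_mem_potentialGraphClosure (hL : 0 < L) {G : Lp ℝ³ 2 (cellMeasure L)} (hG : G ∈ gradSpace L) :
    ∃ p : Lp ℝ 2 (cellMeasure L), (p, G) ∈ potentialGraphClosure L := by
  have hG' : G ∈ closure (gradRange L : Set (Lp ℝ³ 2 (cellMeasure L))) := by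
    rw [← coe_gradSpace]; exact hG
  obtain ⟨u, hu, hlim⟩ := mem_closure_iff_seq_limit.1 hG'
  choose q hq hqu using hu
  obtain ⟨pn, hpn⟩ : ∃ pn : ℕ → Lp ℝ 2 (cellMeasure L),
      pn = fun n => toCell L (fun x => q n x - ⨍ y in (cylinderCell L : Set ℝ³), q n y) := ⟨_, rfl⟩
  have hmem : ∀ n, (pn n, u n) ∈ potentialGraph L := fun n => by
    rw [hqu n, hpn]
    exact mk_sub_average_mem_potentialGraph (hq n)
  obtain ⟨C, hC⟩ : ∃ C : ℝ, C = cellPoincareConst L := ⟨_, rfl⟩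
  have hC0 : 0 ≤ C := hC ▸ cellPoincareConst_nonneg
  have hbound : ∀ n m, ‖pn n - pn m‖ ≤ C * ‖u n - u m‖ := fun n m => by
    have h := norm_fst_le_of_mem_potentialGraph hL ((potentialGraph L).sub_mem (hmem n) (hmem m))
    rw [Prod.fst_sub, Prod.snd_sub, ← hC] at h
    exact h
  have hcau : CauchySeq pn := by
    rw [Metric.cauchySeq_iff]
    intro ε hε
    obtain ⟨N, hN⟩ := Metric.cauchySeq_iff.1 hlim.cauchySeq (ε / (C + 1)) (by positivity)
    refine ⟨N, fun m hm n hn => ?_⟩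
    rw [dist_eq_norm]
    have h1 := hN m hm n hn
    rw [dist_eq_norm] at h1
    calc ‖pn m - pn n‖ ≤ C * ‖u m - u n‖ := hbound m n
      _ ≤ (C + 1) * ‖u m - u n‖ := by gcongr; linarith
      _ < (C + 1) * (ε / (C + 1)) := by gcongr
      _ = ε := by field_simp
  obtain ⟨p, hp⟩ := cauchySeq_tendsto_of_complete hcau
  refine ⟨p, ?_⟩
  rw [← SetLike.mem_coe, coe_potentialGraphClosure]
  exact mem_closure_of_tendsto (hp.prodMk_nhds hlim) (Eventually.of_forall fun n => hmem n)

/-- **Uniqueness of the mean-zero potential**. [folklore] -/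
theorem fst_unique_of_mem_potentialGraphClosure (hL : 0 < L) {p p' : Lp ℝ 2 (cellMeasure L)}
    {G : Lp ℝ³ 2 (cellMeasure L)} (h : (p, G) ∈ potentialGraphClosure L)
    (h' : (p', G) ∈ potentialGraphClosure L) : p = p' := by
  have hsub : (p - p', (0 : Lp ℝ³ 2 (cellMeasure L))) ∈ potentialGraphClosure L := by
    have := (potentialGraphClosure L).sub_mem h h'
    rwa [Prod.mk_sub_mk, sub_self] at this
  have hle := norm_fst_le_of_mem_potentialGraphClosure hL hsub
  simp only [norm_zero, mul_zero, norm_le_zero_iff] at hle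
  exact sub_eq_zero.1 hle

/-- **The mean-zero potential of an `L²` gradient** (`0` if `L ≤ 0`, junk). [folklore] -/
def potential (G : gradSpace L) : Lp ℝ 2 (cellMeasure L) :=
  if h : 0 < L then Classical.choose (exists_mem_potentialGraphClosure h G.2) else 0

/-- `(potential G, G)` lies in the closed potential graph. [folklore] -/
theorem potential_mem (hL : 0 < L) (G : gradSpace L) :
    (potential G, (G : Lp ℝ³ 2 (cellMeasure L))) ∈ potentialGraphClosure L := by
  rw [potential, dif_pos hL]
  exact Classical.choose_spec (exists_mem_potentialGraphClosure hL G.2)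

/-- Junk value: the potential is `0` when `L ≤ 0`. [folklore] -/
theorem potential_of_nonpos (hL : L ≤ 0) (G : gradSpace L) : potential G = 0 := by
  rw [potential, dif_neg (not_lt.2 hL)]

/-- Characterisation: the potential is the unique `p` with `(p, G)` in the closed graph. [folklore] -/
theorem potential_eq_of_mem (hL : 0 < L) (G : gradSpace L) {p : Lp ℝ 2 (cellMeasure L)}
    (hp : (p, (G : Lp ℝ³ 2 (cellMeasure L))) ∈ potentialGraphClosure L) : potential G = p :=
  fst_unique_of_mem_potentialGraphClosure hL (potential_mem hL G) hp

/-- The potential is additive. [folklore] -/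
theorem potential_add (G G' : gradSpace L) : potential (G + G') = potential G + potential G' := by
  rcases le_or_gt L 0 with hL | hL
  · simp [potential_of_nonpos hL]
  · refine potential_eq_of_mem hL _ ?_
    have := (potentialGraphClosure L).add_mem (potential_mem hL G) (potential_mem hL G')
    rwa [Prod.mk_add_mk] at this

/-- The potential is homogeneous. [folklore] -/
theorem potential_smul (c : ℝ) (G : gradSpace L) : potential (c • G) = c • potential G := by
  rcases le_or_gt L 0 with hL | hL
  · simp [potential_of_nonpos hL]
  · refine potential_eq_of_mem hL _ ?_
    have := (potentialGraphClosure L).smul_mem c (potential_mem hL G)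
    rwa [Prod.smul_mk] at this

/-- **Poincaré**: `‖potential G‖ ≤ C_P ‖G‖`. [folklore] -/
theorem norm_potential_le (G : gradSpace L) : ‖potential G‖ ≤ cellPoincareConst L * ‖G‖ := by
  rcases le_or_gt L 0 with hL | hL
  · rw [potential_of_nonpos hL, norm_zero]
    exact mul_nonneg cellPoincareConst_nonneg (norm_nonneg _)
  · have h := norm_fst_le_of_mem_potentialGraphClosure hL (potential_mem hL G)
    rw [Prod.fst, Prod.snd] at h
    exact h

variable (L) in
/-- The mean-zero potential as a continuous linear map `𝓖 → L²(cell)`. [folklore] -/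
def potentialL : gradSpace L →L[ℝ] Lp ℝ 2 (cellMeasure L) :=
  LinearMap.mkContinuous
    { toFun := potential
      map_add' := potential_add
      map_smul' := potential_smul }
    (cellPoincareConst L) fun G => norm_potential_le G

/-- Unfolding `potentialL`. [folklore] -/
@[simp]
theorem potentialL_apply (G : gradSpace L) : potentialL L G = potential G := rfl

/-- The potential of a smooth gradient is the smooth function minus its mean. [folklore] -/
theorem potential_toCell_cylGrad (hL : 0 < L) {q : ℝ³ → ℝ} (hq : IsSmoothPeriodic L q) :
    potential ⟨toCell L (cylGrad q), gradRange_le_gradSpace (toCell_cylGrad_mem_gradRange hq)⟩ =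
      toCell L (fun x => q x - ⨍ y in (cylinderCell L : Set ℝ³), q y) :=
  potential_eq_of_mem hL _ (potentialGraph_le_closure (mk_sub_average_mem_potentialGraph hq))

/-- The potential has zero mean. [folklore] -/
theorem integral_potential_eq_zero (G : gradSpace L) :
    ∫ x in (cylinderCell L : Set ℝ³), potential G x = 0 := by
  rcases le_or_gt L 0 with hL | hL
  · rw [potential_of_nonpos hL, integral_congr_ae (Lp.coeFn_zero ℝ 2 (cellMeasure L))]
    exact integral_zero _ _
  · rw [integral_eq_inner_toCell_one]
    exact inner_toCell_one_fst_eq_zero_of_mem_potentialGraphClosure (potential_mem hL G)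

/-- **`G` is the weak gradient of its potential** on the open cell. [folklore] -/
theorem hasWeakFDerivOn_potential (hL : 0 < L) (G : gradSpace L) :
    HasWeakFDerivOn (cylinderCell L) volume (potential G : ℝ³ → ℝ)
      (fun x => (innerSL ℝ (((G : Lp ℝ³ 2 (cellMeasure L)) : ℝ³ → ℝ³) x) : ℝ³ →L[ℝ] ℝ)) :=
  hasWeakFDerivOn_of_mem_potentialGraphClosure (potential_mem hL G)

/-! ### Weak solutions of the periodic Neumann problem -/

variable (L) in
/-- **The data functional of the weak Neumann problem** with data `h₀ ∈ L²(cell)`, `h₁ ∈ L²(cell; ℝ³)`: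
`Ψ ↦ ⟪h₀, pot Ψ⟫ + ⟪h₁, Ψ⟫` on `𝓖`, i.e. `∇ψ ↦ ∫ h₀ (ψ − ⨍ψ) + ∫ ⟪h₁, ∇ψ⟫` — the weak form of
`Δq = div h₁ − h₀` in the cylinder, `∂q/∂n = h₁ · n` on the wall, periodic in `z`. [folklore] -/
def neumannFunctional (h₀ : Lp ℝ 2 (cellMeasure L)) (h₁ : Lp ℝ³ 2 (cellMeasure L)) :
    gradSpace L →L[ℝ] ℝ :=
  (innerSL ℝ h₀).comp (potentialL L) + (innerSL ℝ h₁).comp (gradSpace L).subtypeL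

/-- Unfolding the data functional. [folklore] -/
theorem neumannFunctional_apply (h₀ : Lp ℝ 2 (cellMeasure L)) (h₁ : Lp ℝ³ 2 (cellMeasure L))
    (Ψ : gradSpace L) :
    neumannFunctional L h₀ h₁ Ψ = ⟪h₀, potential Ψ⟫ + ⟪h₁, (Ψ : Lp ℝ³ 2 (cellMeasure L))⟫ := rfl

variable (L) in
/-- **The weak solution of the periodic Neumann problem** (its gradient): the Riesz representative in
`𝓖` of the data functional — the unique `G ∈ 𝓖` with `⟪G, Ψ⟫ = ⟪h₀, pot Ψ⟫ + ⟪h₁, Ψ⟫` for all `Ψ ∈ 𝓖`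
(Lax–Milgram for the Dirichlet form on mean-zero periodic `H¹`, which on `𝓖` is the inner product
itself). [folklore] -/
def neumannGrad (h₀ : Lp ℝ 2 (cellMeasure L)) (h₁ : Lp ℝ³ 2 (cellMeasure L)) : gradSpace L :=
  (InnerProductSpace.toDual ℝ (gradSpace L)).symm (neumannFunctional L h₀ h₁)

/-- The defining identity of the weak solution, tested against `𝓖`. [folklore] -/
theorem inner_neumannGrad (h₀ : Lp ℝ 2 (cellMeasure L)) (h₁ : Lp ℝ³ 2 (cellMeasure L)) (Ψ : gradSpace L) :
    ⟪neumannGrad L h₀ h₁, Ψ⟫ = ⟪h₀, potential Ψ⟫ + ⟪h₁, (Ψ : Lp ℝ³ 2 (cellMeasure L))⟫ := by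
  rw [neumannGrad, InnerProductSpace.toDual_symm_apply, neumannFunctional_apply]

/-- **Uniqueness**: an element of `𝓖` with the same inner products against all smooth gradients is the
weak solution. [folklore] -/
theorem eq_neumannGrad_of_forall_inner (h₀ : Lp ℝ 2 (cellMeasure L)) (h₁ : Lp ℝ³ 2 (cellMeasure L))
    {G : gradSpace L}
    (hG : ∀ (q : ℝ³ → ℝ) (hq : IsSmoothPeriodic L q),
      ⟪(G : Lp ℝ³ 2 (cellMeasure L)), toCell L (cylGrad q)⟫ =
        neumannFunctional L h₀ h₁ ⟨toCell L (cylGrad q), gradRange_le_gradSpace (toCell_cylGrad_mem_gradRange hq)⟩) :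
    G = neumannGrad L h₀ h₁ := by
  -- the difference is orthogonal to the smooth gradients, hence to `𝓖`, and lies in `𝓖`
  have hdiff : ((G : Lp ℝ³ 2 (cellMeasure L)) - neumannGrad L h₀ h₁) ∈ (gradSpace L)ᗮ := by
    rw [gradSpace_orthogonal_eq, Submodule.mem_orthogonal']
    rintro _ ⟨q, hq, rfl⟩
    rw [inner_sub_left, hG q hq, sub_eq_zero, neumannFunctional_apply, ← inner_neumannGrad,
      Submodule.coe_inner]
  have hmem : ((G : Lp ℝ³ 2 (cellMeasure L)) - neumannGrad L h₀ h₁) ∈ gradSpace L :=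
    (gradSpace L).sub_mem G.2 (neumannGrad L h₀ h₁).2
  have h0 := Submodule.inf_orthogonal_eq_bot (gradSpace L)
  have hz : ((G : Lp ℝ³ 2 (cellMeasure L)) - neumannGrad L h₀ h₁) ∈ gradSpace L ⊓ (gradSpace L)ᗮ :=
    ⟨hmem, hdiff⟩
  rw [h0, Submodule.mem_bot, sub_eq_zero] at hz
  exact Subtype.ext hz

/-- **The weak solution bound** `‖G‖ ≤ C_P ‖h₀‖ + ‖h₁‖`. [folklore] -/
theorem norm_neumannGrad_le (h₀ : Lp ℝ 2 (cellMeasure L)) (h₁ : Lp ℝ³ 2 (cellMeasure L)) :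
    ‖neumannGrad L h₀ h₁‖ ≤ cellPoincareConst L * ‖h₀‖ + ‖h₁‖ := by
  set G := neumannGrad L h₀ h₁ with hGdef
  have h := inner_neumannGrad h₀ h₁ G
  rw [real_inner_self_eq_norm_sq] at h
  have h1 : |⟪h₀, potential G⟫| ≤ ‖h₀‖ * (cellPoincareConst L * ‖G‖) :=
    (abs_real_inner_le_norm _ _).trans (mul_le_mul_of_nonneg_left (norm_potential_le G) (norm_nonneg _))
  have h2 : |⟪h₁, (G : Lp ℝ³ 2 (cellMeasure L))⟫| ≤ ‖h₁‖ * ‖G‖ :=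
    abs_real_inner_le_norm h₁ (G : Lp ℝ³ 2 (cellMeasure L))
  have hsq : ‖G‖ ^ 2 ≤ (cellPoincareConst L * ‖h₀‖ + ‖h₁‖) * ‖G‖ := by
    rw [h]
    have := (le_abs_self _).trans ((abs_add_le _ _).trans (add_le_add h1 h2))
    nlinarith
  by_cases hG0 : ‖G‖ = 0
  · rw [hG0]
    exact add_nonneg (mul_nonneg cellPoincareConst_nonneg (norm_nonneg _)) (norm_nonneg _)
  · have hGpos : 0 < ‖G‖ := lt_of_le_of_ne (norm_nonneg _) (Ne.symm hG0)
    exact le_of_mul_le_mul_right (by nlinarith [hsq]) hGpos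

/-- **The weak Neumann problem with `h₀ = 0` is solved by the Helmholtz projection**: `∇q = Q h₁`.
[folklore] -/
theorem coe_neumannGrad_zero_left (h₁ : Lp ℝ³ 2 (cellMeasure L)) :
    ((neumannGrad L 0 h₁ : gradSpace L) : Lp ℝ³ 2 (cellMeasure L)) = helmholtzProj L h₁ := by
  symm
  have hmem : helmholtzProj L h₁ ∈ gradSpace L := helmholtzProj_mem h₁
  suffices h : (⟨helmholtzProj L h₁, hmem⟩ : gradSpace L) = neumannGrad L 0 h₁ by
    rw [← h]
  refine eq_neumannGrad_of_forall_inner 0 h₁ fun q hq => ?_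
  rw [neumannFunctional_apply, inner_zero_left, zero_add]
  show ⟪helmholtzProj L h₁, toCell L (cylGrad q)⟫ = ⟪h₁, toCell L (cylGrad q)⟫
  rw [helmholtzProj_apply, Submodule.inner_starProjection_left_eq_right,
    Submodule.starProjection_eq_self_iff.2 (gradRange_le_gradSpace (toCell_cylGrad_mem_gradRange hq))]

/-- **The weak Neumann problem tested against smooth periodic functions**: for data with `∫_cell h₀ = 0`,
`∫_cell ⟪∇q, ∇ψ⟫ = ∫_cell h₀ ψ + ∫_cell ⟪h₁, ∇ψ⟫` for every smooth periodic `ψ`, where `∇q = neumannGrad h₀ h₁`.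
[folklore] -/
theorem setIntegral_inner_neumannGrad_cylGrad (hL : 0 < L) {h₀ : Lp ℝ 2 (cellMeasure L)}
    (hmean : ∫ x in (cylinderCell L : Set ℝ³), h₀ x = 0) (h₁ : Lp ℝ³ 2 (cellMeasure L))
    {ψ : ℝ³ → ℝ} (hψ : IsSmoothPeriodic L ψ) :
    ∫ x in (cylinderCell L : Set ℝ³), ⟪((neumannGrad L h₀ h₁ : gradSpace L) : Lp ℝ³ 2 (cellMeasure L)) x, cylGrad ψ x⟫ =
      (∫ x in (cylinderCell L : Set ℝ³), h₀ x * ψ x) +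
        ∫ x in (cylinderCell L : Set ℝ³), ⟪h₁ x, cylGrad ψ x⟫ := by
  have h := inner_neumannGrad h₀ h₁
    ⟨toCell L (cylGrad ψ), gradRange_le_gradSpace (toCell_cylGrad_mem_gradRange hψ)⟩
  rw [Submodule.coe_inner, potential_toCell_cylGrad hL hψ] at h
  have hsplit : toCell L (fun x => ψ x - ⨍ y in (cylinderCell L : Set ℝ³), ψ y) =
      toCell L ψ - toCell L (fun _ : ℝ³ => ⨍ y in (cylinderCell L : Set ℝ³), ψ y) :=
    toCell_sub hψ.memLp (isSmoothPeriodic_const (L := L) _).memLp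
  have hconst : ⟪h₀, toCell L (fun _ : ℝ³ => ⨍ y in (cylinderCell L : Set ℝ³), ψ y)⟫ = 0 := by
    rw [inner_toCell_right _ (isSmoothPeriodic_const (L := L) _).memLp]
    have hpt : ∀ x : ℝ³, ⟪(h₀ : ℝ³ → ℝ) x, ⨍ y in (cylinderCell L : Set ℝ³), ψ y⟫ =
        (h₀ : ℝ³ → ℝ) x * ⨍ y in (cylinderCell L : Set ℝ³), ψ y := fun x => by
      simp [mul_comm]
    simp_rw [hpt]
    rw [integral_mul_const, hmean, zero_mul]
  have hmain : ⟪h₀, toCell L ψ⟫ = ∫ x in (cylinderCell L : Set ℝ³), (h₀ : ℝ³ → ℝ) x * ψ x := by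
    rw [inner_toCell_right _ hψ.memLp]
    exact integral_congr_ae (Eventually.of_forall fun x => by simp [mul_comm])
  rw [hsplit, inner_sub_right, hconst, sub_zero, hmain, inner_toCell_right _ hψ.cylGrad.memLp] at h
  rw [inner_toCell_right _ hψ.cylGrad.memLp] at h
  exact h

end PeriodicCylinder

end Literature.Analysis.FluidPDE
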